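import Literature.NumberTheory.Automorphic.HeckeFixedVectorsSimple
import HarnessLib

/-!
# Hecke-equivariant maps on `K`-fixed vectors of irreducibles lift to `G`-isomorphisms

Topic `NumberTheory/Automorphic`; generic sequel of `HeckeFixedVectorsSimple` (Bump, Prop. 4.2.3:
`V^K` is a simple module over the Hecke operators `[KgK]`).  Everything here is PROVED, purely
algebraically (no topology, no Haar measure, no smoothness): the standing hypothesis is the Hecke-pair
condition `∀ g, (K·gK ⊆ G/K).Finite` (every double coset `KgK` is a finite union of left cosets, e.g.
`K` compact open in a locally profinite `G`) over a field `k` of characteristic zero.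

## Main result

* `exists_equiv_of_heckeEquivariant` (**Bushnell–Henniart, §4.3 Proposition; Bump, Prop. 4.2.3 /
  Thm. 4.6.2 circle of ideas**): let `ρ`, `σ` be IRREDUCIBLE representations of `G` on `V`, `W`
  (Mathlib `Representation.IsIrreducible`) and `φ : V →ₗ W` a linear map sending `V^K` into `W^K`,
  commuting there with every Hecke operator `[KgK]`, and non-zero on `V^K`.  Then `φ|_{V^K}` is the
  restriction of an isomorphism of representations `ρ ≃ σ`.  In particular (the form used for
  multiplicity-one bookkeeping) two irreducibles whose `K`-fixed vectors admit a non-zero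
  Hecke-equivariant map are isomorphic (`nonempty_equiv_of_heckeEquivariant`), equivalently
  non-isomorphic irreducibles admit NO non-zero Hecke-equivariant map between their `K`-fixed
  vectors (`eq_zero_of_heckeEquivariant_of_isEmpty_equiv`); every Hecke-equivariant map on `V^K`
  is the restriction of an intertwiner (`exists_intertwiningMap_of_heckeEquivariant`); and a
  non-zero one is a bijection `V^K → W^K` (`injOn_and_surjOn_fixedPoints_of_heckeEquivariant`).

## Proof (the graph argument)

`Γ = {(v, φ v) | v ∈ V^K} ≤ V ⊕ W`, `U` = the `k`-span of its `G`-translates in `ρ ⊕ σ` (a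
subrepresentation).  KEY (the coset-sum step of Bump's proof of Prop. 4.2.3, factored WITHOUT
irreducibility as `mem_of_mem_span_translates_of_mem_fixedPoints`): a `K`-fixed vector in the
`G`-span of a Hecke-stable `Γ ≤ (V ⊕ W)^K` lies in `Γ`; so `U^K = Γ`.  The projections `U → V`,
`U → W` are intertwiners with non-zero image (surjective); their kernels are copies of
subrepresentations of `σ`, `ρ` WITHOUT non-zero `K`-fixed vectors (`Γ ∩ (0 ⊕ W) = 0`,
`Γ ∩ (V ⊕ 0) ⊆ ker φ`), hence `⊥` — so both are isomorphisms and `pr₂ ∘ pr₁⁻¹` is the lift.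
[cite: BushnellHenniart2006, §4.3 Proposition] [cite: Bump1997, Prop. 4.2.3]

## References

* C. J. Bushnell, G. Henniart, *The Local Langlands Conjecture for GL(2)*, Grundlehren 335 (2006),
  §4.3 Proposition (irreducible smooth `V` with `V^K ≠ 0` ↦ simple `ℋ(G,K)`-module `V^K` is a
  bijection on isomorphism classes) [BushnellHenniart2006].
* D. Bump, *Automorphic Forms and Representations*, Cambridge Stud. Adv. Math. 55 (1997),
  Prop. 4.2.3 (p. 427) [Bump1997].
-/

noncomputable section

open MulAction

namespace Literature.NumberTheory.Automorphic

/-! ### The key coset-sum step of Bump 4.2.3, without irreducibility -/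

section Span

variable {k G V : Type*} [CommRing k] [Group G] [AddCommGroup V] [Module k V]
  (ρ : Representation k G V)

/-- The `k`-span of the `G`-translates of a subspace `W` is `G`-stable — the subrepresentation
generated by `W` (first step of Bump's proof of Prop. 4.2.3). [cite: Bump1997, Prop. 4.2.3 (proof)] -/
theorem map_span_translates_le (W : Submodule k V) (g : G) :
    (Submodule.span k (⋃ h : G, ρ h '' (W : Set V))).map (ρ g) ≤
      Submodule.span k (⋃ h : G, ρ h '' (W : Set V)) := by
  rw [Submodule.map_span]
  refine Submodule.span_mono ?_
  rintro _ ⟨x, hx, rfl⟩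
  obtain ⟨h, hxh⟩ := Set.mem_iUnion.1 hx
  obtain ⟨w, hw, rfl⟩ := hxh
  refine Set.mem_iUnion.2 ⟨g * h, w, hw, ?_⟩
  rw [map_mul, Module.End.mul_apply]

end Span

section Key

variable {k G V : Type*} [Field k] [CharZero k] [Group G] [AddCommGroup V] [Module k V]
  (ρ : Representation k G V) (K : Subgroup G)

/-- **Key step of Bump's Prop. 4.2.3, factored without irreducibility.** Let every double coset
`KgK` be a finite union of left cosets, `k` of characteristic zero, and `W ≤ V^K` a subspace stable
under every Hecke operator `[KgK]`.  Then every `K`-FIXED vector in the `k`-span of the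
`G`-translates of `W` already lies in `W`: for `u` in the span there is a finite-index `B ≤ K`
fixing `u` all of whose coset sums `∑_{K/A} ρ(c) u` (`A ≤ B` of finite index) lie in `W`
(for `u = ρ(g) w` this sum is `[K ∩ gKg⁻¹ : A] • [KgK] w`), and for `u = v ∈ V^K` the coset sum is
`[K:B] • v`. [cite: Bump1997, Prop. 4.2.3 (proof)] -/
theorem mem_of_mem_span_translates_of_mem_fixedPoints
    (hfin : ∀ g : G, (orbit K (g : G ⧸ K)).Finite) {W : Submodule k V}
    (hWK : W ≤ ρ.fixedPoints K) (hstab : ∀ g : G, ∀ w ∈ W, heckeOperator ρ K g w ∈ W)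
    {v : V} (hvS : v ∈ Submodule.span k (⋃ g : G, ρ g '' (W : Set V)))
    (hv : v ∈ ρ.fixedPoints K) : v ∈ W := by
  classical
  -- every vector of the span is fixed by a finite-index `B ≤ K`, with all coset sums in `W`
  have key : ∀ u ∈ Submodule.span k (⋃ g : G, ρ g '' (W : Set V)), ∃ B : Subgroup K, B.FiniteIndex ∧
      u ∈ Representation.fixedPoints (ρ.comp K.subtype) B ∧ ∀ A : Subgroup K, A ≤ B → A.FiniteIndex →
        ∑ᶠ c : K ⧸ A, (ρ.comp K.subtype) c.out u ∈ W := by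
    intro u hu
    induction hu using Submodule.span_induction with
    | mem x hx =>
      obtain ⟨g, hxg⟩ := Set.mem_iUnion.1 hx
      obtain ⟨w, hw, rfl⟩ := hxg
      refine ⟨stabilizer K (g : G ⧸ K), finiteIndex_stabilizer K g (hfin g),
        apply_mem_fixedPoints_stabilizer ρ K g (hWK hw), fun A hA _ => ?_⟩
      rw [finsum_apply_out_eq_relIndex_smul (ρ.comp K.subtype) hA
          (apply_mem_fixedPoints_stabilizer ρ K g (hWK hw)),
        finsum_stabilizer_apply_eq_heckeOperator ρ K g (hfin g) (hWK hw)]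
      exact nsmul_mem (hstab g w hw) _
    | zero =>
      refine ⟨⊤, inferInstance, Submodule.zero_mem _, fun A _ _ => ?_⟩
      simp only [map_zero, finsum_zero]
      exact W.zero_mem
    | add x y _ _ ihx ihy =>
      obtain ⟨B₁, hB₁, hx₁, h₁⟩ := ihx
      obtain ⟨B₂, hB₂, hy₂, h₂⟩ := ihy
      refine ⟨B₁ ⊓ B₂, ⟨Subgroup.index_inf_ne_zero hB₁.index_ne_zero hB₂.index_ne_zero⟩,
        Submodule.add_mem _ (Representation.fixedPoints_antitone (ρ.comp K.subtype) inf_le_left hx₁)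
          (Representation.fixedPoints_antitone (ρ.comp K.subtype) inf_le_right hy₂),
        fun A hA hAfi => ?_⟩
      letI : Fintype (K ⧸ A) := Fintype.ofFinite _
      simp only [map_add, finsum_eq_sum_of_fintype, Finset.sum_add_distrib]
      have hx' := h₁ A (hA.trans inf_le_left) hAfi
      have hy' := h₂ A (hA.trans inf_le_right) hAfi
      rw [finsum_eq_sum_of_fintype] at hx' hy'
      exact W.add_mem hx' hy'
    | smul a x _ ih =>
      obtain ⟨B, hB, hxB, h⟩ := ih
      refine ⟨B, hB, Submodule.smul_mem _ a hxB, fun A hA hAfi => ?_⟩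
      letI : Fintype (K ⧸ A) := Fintype.ofFinite _
      simp only [map_smul, finsum_eq_sum_of_fintype, ← Finset.smul_sum]
      have hx' := h A hA hAfi
      rw [finsum_eq_sum_of_fintype] at hx'
      exact W.smul_mem a hx'
  obtain ⟨B, hBfi, -, hB⟩ := key v hvS
  have hvinv : v ∈ Representation.invariants (ρ.comp K.subtype) := hv
  have hmem := hB B le_rfl hBfi
  rw [finsum_apply_out_eq_index_smul (ρ.comp K.subtype) B hvinv, ← Nat.cast_smul_eq_nsmul k] at hmem
  have hidx : (B.index : k) ≠ 0 := Nat.cast_ne_zero.2 hBfi.index_ne_zero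
  rw [show v = (B.index : k)⁻¹ • ((B.index : k) • v) by
    rw [smul_smul, inv_mul_cancel₀ hidx, one_smul]]
  exact W.smul_mem _ hmem

end Key

/-! ### `K`-fixed vectors and Hecke operators on a direct sum `ρ ⊕ σ` -/

section Prod

variable {k G V W : Type*} [CommRing k] [Group G] [AddCommGroup V] [Module k V]
  [AddCommGroup W] [Module k W] (ρ : Representation k G V) (σ : Representation k G W) (K : Subgroup G)

/-- The direct-sum representation acts componentwise (plumbing, `rfl`). [folklore] -/
private theorem prod_apply_apply (g : G) (x : V × W) : (ρ.prod σ) g x = (ρ g x.1, σ g x.2) := rfl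

/-- `(V ⊕ W)^K = V^K ⊕ W^K` (`V ↦ V^K` is additive). [cite: BernsteinZelevinsky1976, §2.1] -/
theorem mem_fixedPoints_prod (x : V × W) :
    x ∈ (ρ.prod σ).fixedPoints K ↔ x.1 ∈ ρ.fixedPoints K ∧ x.2 ∈ σ.fixedPoints K := by
  simp only [Representation.mem_fixedPoints, prod_apply_apply, Prod.ext_iff]
  exact ⟨fun h => ⟨fun g hg => (h g hg).1, fun g hg => (h g hg).2⟩, fun h g hg => ⟨h.1 g hg, h.2 g hg⟩⟩

/-- The Hecke operator `[KgK] = ∑_{yK ⊆ KgK} ρ(y)` of a direct sum acts componentwise (functoriality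
of `V ↦ V^K` as an `ℋ(G,K)`-module). [cite: BushnellHenniart2006, §4.1] -/
theorem heckeOperator_prod_apply (g : G) (hfin : (orbit K (g : G ⧸ K)).Finite) (x : V × W) :
    heckeOperator (ρ.prod σ) K g x = (heckeOperator ρ K g x.1, heckeOperator σ K g x.2) := by
  classical
  rw [Prod.ext_iff]
  simp only [heckeOperator, finsum_mem_eq_finite_toFinset_sum _ hfin, LinearMap.coe_sum,
    Finset.sum_apply, prod_apply_apply, Prod.fst_sum, Prod.snd_sum, and_self]

end Prod

/-! ### The lift -/

section Lift

variable {k G V W : Type*} [Field k] [CharZero k] [Group G] [AddCommGroup V] [Module k V]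
  [AddCommGroup W] [Module k W] (ρ : Representation k G V) (σ : Representation k G W) (K : Subgroup G)

/-- **Hecke-equivariant maps on `K`-fixed vectors of irreducibles lift to isomorphisms**
(Bushnell–Henniart, *The Local Langlands Conjecture for GL(2)*, §4.3 Proposition; the
`(ii) ⇒ (iii)`-mechanism of Bump, Prop. 4.2.3).  Let every double coset `KgK` be a finite union of
left cosets, `k` of characteristic zero, `ρ`, `σ` irreducible, and `φ : V →ₗ W` linear with
`φ(V^K) ⊆ W^K`, `φ ∘ [KgK] = [KgK] ∘ φ` on `V^K` for all `g`, and `φ|_{V^K} ≠ 0`.  Then there is an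
isomorphism of representations `e : ρ ≃ σ` with `e = φ` on `V^K`.
[cite: BushnellHenniart2006, §4.3 Proposition] [cite: Bump1997, Prop. 4.2.3] -/
theorem exists_equiv_of_heckeEquivariant [ρ.IsIrreducible] [σ.IsIrreducible]
    (hfin : ∀ g : G, (orbit K (g : G ⧸ K)).Finite) (φ : V →ₗ[k] W)
    (hφK : ∀ v ∈ ρ.fixedPoints K, φ v ∈ σ.fixedPoints K)
    (hφT : ∀ g : G, ∀ v ∈ ρ.fixedPoints K, φ (heckeOperator ρ K g v) = heckeOperator σ K g (φ v))
    (hφ0 : ∃ v ∈ ρ.fixedPoints K, φ v ≠ 0) :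
    ∃ e : ρ.Equiv σ, ∀ v ∈ ρ.fixedPoints K, e v = φ v := by
  classical
  obtain ⟨v₀, hv₀K, hv₀⟩ := hφ0
  -- the graph of `φ|_{V^K}` inside `V ⊕ W`
  let Γ : Submodule k (V × W) := (ρ.fixedPoints K).map ((LinearMap.id : V →ₗ[k] V).prod φ)
  have hΓmem : ∀ {x : V × W}, x ∈ Γ ↔ x.1 ∈ ρ.fixedPoints K ∧ x.2 = φ x.1 := by
    intro x
    constructor
    · rintro ⟨v, hv, rfl⟩
      exact ⟨hv, rfl⟩
    · rintro ⟨h1, h2⟩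
      exact ⟨x.1, h1, Prod.ext rfl h2.symm⟩
  have hΓK : Γ ≤ (ρ.prod σ).fixedPoints K := by
    intro x hx
    rw [mem_fixedPoints_prod]
    exact ⟨(hΓmem.1 hx).1, (hΓmem.1 hx).2 ▸ hφK _ (hΓmem.1 hx).1⟩
  have hΓstab : ∀ g : G, ∀ x ∈ Γ, heckeOperator (ρ.prod σ) K g x ∈ Γ := by
    intro g x hx
    obtain ⟨h1, h2⟩ := hΓmem.1 hx
    rw [heckeOperator_prod_apply ρ σ K g (hfin g), hΓmem]
    refine ⟨heckeOperator_apply_mem_fixedPoints ρ K g h1 (hfin g), ?_⟩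
    rw [h2, hφT g _ h1]
  -- `U` := the `G`-span of the graph, a subrepresentation of `ρ ⊕ σ`
  let S : Submodule k (V × W) := Submodule.span k (⋃ g : G, (ρ.prod σ) g '' (Γ : Set (V × W)))
  let U : Subrepresentation (ρ.prod σ) :=
    ⟨S, fun g x hx => map_span_translates_le (ρ.prod σ) Γ g (Submodule.mem_map_of_mem hx)⟩
  have hΓU : ∀ {x}, x ∈ Γ → x ∈ S := fun {x} hx =>
    Submodule.subset_span (Set.mem_iUnion.2 ⟨1, x, hx, by rw [map_one, Module.End.one_apply]⟩)
  -- KEY: `U^K = Γ`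
  have hUK : ∀ {x}, x ∈ S → x ∈ (ρ.prod σ).fixedPoints K → x ∈ Γ := fun {x} hxS hxK =>
    mem_of_mem_span_translates_of_mem_fixedPoints (ρ.prod σ) K hfin hΓK hΓstab hxS hxK
  -- the two projections as intertwiners out of `U`
  let p : (U.toRepresentation).IntertwiningMap ρ :=
    ⟨LinearMap.fst k V W ∘ₗ S.subtype, fun g => by ext u; rfl⟩
  let q : (U.toRepresentation).IntertwiningMap σ :=
    ⟨LinearMap.snd k V W ∘ₗ S.subtype, fun g => by ext u; rfl⟩
  have hp_apply : ∀ u : S, p u = (u : V × W).1 := fun _ => rfl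
  have hq_apply : ∀ u : S, q u = (u : V × W).2 := fun _ => rfl
  have hγ₀ : ((v₀, φ v₀) : V × W) ∈ S := hΓU (hΓmem.2 ⟨hv₀K, rfl⟩)
  have hv₀ne : v₀ ≠ 0 := fun h => hv₀ (by rw [h, map_zero])
  -- surjectivity: the images are non-zero subrepresentations of irreducibles
  have hp_surj : Function.Surjective p := by
    have hne : p.range ≠ ⊥ := by
      intro h
      have : v₀ ∈ p.range := ⟨⟨_, hγ₀⟩, rfl⟩
      rw [h] at this
      exact hv₀ne ((Submodule.mem_bot k).1 this)
    exact fun v => (((IsSimpleOrder.eq_bot_or_eq_top p.range).resolve_left hne).ge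
      (Submodule.mem_top (x := v)) : v ∈ p.range)
  have hq_surj : Function.Surjective q := by
    have hne : q.range ≠ ⊥ := by
      intro h
      have : φ v₀ ∈ q.range := ⟨⟨_, hγ₀⟩, rfl⟩
      rw [h] at this
      exact hv₀ ((Submodule.mem_bot k).1 this)
    exact fun w => (((IsSimpleOrder.eq_bot_or_eq_top q.range).resolve_left hne).ge
      (Submodule.mem_top (x := w)) : w ∈ q.range)
  -- injectivity of `p`: the slice `{w | (0, w) ∈ U}` is a subrepresentation of `σ` without `K`-fixed vectors
  have hp_inj : Function.Injective p := by
    let N : Subrepresentation σ :=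
      ⟨S.comap (LinearMap.inr k V W), fun g w (hw : ((0 : V), w) ∈ S) => by
        have h := U.apply_mem_toSubmodule g hw
        change (ρ g 0, σ g w) ∈ S at h
        rw [map_zero] at h
        exact h⟩
    have hNbot : N = ⊥ := by
      refine (IsSimpleOrder.eq_bot_or_eq_top N).resolve_right fun htop => hv₀ ?_
      have hmem : φ v₀ ∈ N.toSubmodule := by rw [htop]; exact Submodule.mem_top
      have hΓ0 : ((0 : V), φ v₀) ∈ Γ :=
        hUK hmem ((mem_fixedPoints_prod ρ σ K _).2 ⟨Submodule.zero_mem _, hφK _ hv₀K⟩)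
      exact ((hΓmem.1 hΓ0).2).trans (map_zero φ)
    intro u₁ u₂ h
    rw [← sub_eq_zero]
    have hsub : p (u₁ - u₂) = 0 := by rw [map_sub, h, sub_self]
    set u := u₁ - u₂ with hu
    have hu2 : (u : V × W).2 ∈ N.toSubmodule := by
      change ((0 : V), (u : V × W).2) ∈ S
      have : (u : V × W) = ((0 : V), (u : V × W).2) := Prod.ext (by simpa [hp_apply] using hsub) rfl
      rw [← this]; exact u.2
    rw [hNbot] at hu2
    have h2 : (u : V × W).2 = 0 := (Submodule.mem_bot k).1 hu2
    have h1 : (u : V × W).1 = 0 := by simpa [hp_apply] using hsub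
    exact Subtype.ext (Prod.ext h1 h2)
  -- injectivity of `q`: the slice `{v | (v, 0) ∈ U}` is a subrepresentation of `ρ` whose `K`-fixed
  -- vectors lie in `ker φ`
  have hq_inj : Function.Injective q := by
    let N : Subrepresentation ρ :=
      ⟨S.comap (LinearMap.inl k V W), fun g v (hv : (v, (0 : W)) ∈ S) => by
        have h := U.apply_mem_toSubmodule g hv
        change (ρ g v, σ g 0) ∈ S at h
        rw [map_zero] at h
        exact h⟩
    have hNbot : N = ⊥ := by
      refine (IsSimpleOrder.eq_bot_or_eq_top N).resolve_right fun htop => hv₀ ?_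
      have hmem : v₀ ∈ N.toSubmodule := by rw [htop]; exact Submodule.mem_top
      have hΓ0 : (v₀, (0 : W)) ∈ Γ :=
        hUK hmem ((mem_fixedPoints_prod ρ σ K _).2 ⟨hv₀K, Submodule.zero_mem _⟩)
      exact ((hΓmem.1 hΓ0).2).symm
    intro u₁ u₂ h
    rw [← sub_eq_zero]
    have hsub : q (u₁ - u₂) = 0 := by rw [map_sub, h, sub_self]
    set u := u₁ - u₂ with hu
    have hu1 : (u : V × W).1 ∈ N.toSubmodule := by
      change ((u : V × W).1, (0 : W)) ∈ S
      have : (u : V × W) = ((u : V × W).1, (0 : W)) := Prod.ext rfl (by simpa [hq_apply] using hsub)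
      rw [← this]; exact u.2
    rw [hNbot] at hu1
    have h1 : (u : V × W).1 = 0 := (Submodule.mem_bot k).1 hu1
    have h2 : (u : V × W).2 = 0 := by simpa [hq_apply] using hsub
    exact Subtype.ext (Prod.ext h1 h2)
  -- assemble `e := q ∘ p⁻¹`
  let ep : S ≃ₗ[k] V := LinearEquiv.ofBijective p.toLinearMap ⟨hp_inj, hp_surj⟩
  let eq : S ≃ₗ[k] W := LinearEquiv.ofBijective q.toLinearMap ⟨hq_inj, hq_surj⟩
  have hep : ∀ u : S, ep u = (u : V × W).1 := fun _ => rfl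
  have heq : ∀ u : S, eq u = (u : V × W).2 := fun _ => rfl
  have hep_symm : ∀ (g : G) (v : V), ep.symm (ρ g v) = U.toRepresentation g (ep.symm v) := by
    refine fun g v => ep.injective ?_
    rw [LinearEquiv.apply_symm_apply]
    change ρ g v = p (U.toRepresentation g (ep.symm v))
    rw [p.isIntertwining]
    change ρ g v = ρ g (ep (ep.symm v))
    rw [LinearEquiv.apply_symm_apply]
  refine ⟨Representation.Equiv.mk (ep.symm.trans eq) fun g => ?_, fun v hv => ?_⟩
  · ext v
    change eq (ep.symm (ρ g v)) = σ g (eq (ep.symm v))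
    rw [hep_symm]
    have hq := Representation.IntertwiningMap.isIntertwining _ _ q g (ep.symm v)
    exact hq
  · have hγ : ((v, φ v) : V × W) ∈ S := hΓU (hΓmem.2 ⟨hv, rfl⟩)
    have hsymm : ep.symm v = ⟨(v, φ v), hγ⟩ := by
      apply ep.injective
      rw [LinearEquiv.apply_symm_apply]
      rfl
    change eq (ep.symm v) = φ v
    rw [hsymm]
    rfl

/-- **Corollary (isomorphism classes are detected on `K`-fixed vectors).** Two irreducible
representations whose `K`-fixed vectors admit a non-zero Hecke-equivariant linear map are
isomorphic (Bushnell–Henniart §4.3 Proposition, injectivity of `V ↦ V^K` on isomorphism classes).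
[cite: BushnellHenniart2006, §4.3 Proposition] -/
theorem nonempty_equiv_of_heckeEquivariant [ρ.IsIrreducible] [σ.IsIrreducible]
    (hfin : ∀ g : G, (orbit K (g : G ⧸ K)).Finite) (φ : V →ₗ[k] W)
    (hφK : ∀ v ∈ ρ.fixedPoints K, φ v ∈ σ.fixedPoints K)
    (hφT : ∀ g : G, ∀ v ∈ ρ.fixedPoints K, φ (heckeOperator ρ K g v) = heckeOperator σ K g (φ v))
    (hφ0 : ∃ v ∈ ρ.fixedPoints K, φ v ≠ 0) : Nonempty (ρ.Equiv σ) :=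
  let ⟨e, _⟩ := exists_equiv_of_heckeEquivariant ρ σ K hfin φ hφK hφT hφ0
  ⟨e⟩

/-- **Corollary (rigidity).** A Hecke-equivariant map between the `K`-fixed vectors of two
irreducibles that is non-zero on `V^K` is injective on `V^K` and maps `V^K` ONTO `W^K` (it is the
restriction of a `G`-isomorphism, which carries `V^K` bijectively onto `W^K`).
[cite: BushnellHenniart2006, §4.3 Proposition] -/
theorem injOn_and_surjOn_fixedPoints_of_heckeEquivariant [ρ.IsIrreducible] [σ.IsIrreducible]
    (hfin : ∀ g : G, (orbit K (g : G ⧸ K)).Finite) (φ : V →ₗ[k] W)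
    (hφK : ∀ v ∈ ρ.fixedPoints K, φ v ∈ σ.fixedPoints K)
    (hφT : ∀ g : G, ∀ v ∈ ρ.fixedPoints K, φ (heckeOperator ρ K g v) = heckeOperator σ K g (φ v))
    (hφ0 : ∃ v ∈ ρ.fixedPoints K, φ v ≠ 0) :
    Set.InjOn φ (ρ.fixedPoints K) ∧ Set.SurjOn φ (ρ.fixedPoints K) (σ.fixedPoints K) := by
  obtain ⟨e, he⟩ := exists_equiv_of_heckeEquivariant ρ σ K hfin φ hφK hφT hφ0
  refine ⟨fun v hv v' hv' h => ?_, fun w hw => ?_⟩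
  · rw [← he v hv, ← he v' hv'] at h
    exact e.toLinearEquiv.injective h
  · -- `e⁻¹ w` is `K`-fixed since `e` is equivariant
    rw [SetLike.mem_coe, Representation.mem_fixedPoints] at hw
    have hmem : e.toLinearEquiv.symm w ∈ ρ.fixedPoints K := by
      rw [Representation.mem_fixedPoints]
      intro g hg
      apply e.toLinearEquiv.injective
      have h1 := Representation.IntertwiningMap.isIntertwining _ _ e.toIntertwiningMap g (e.toLinearEquiv.symm w)
      change e.toLinearEquiv (ρ g (e.toLinearEquiv.symm w)) = σ g (e.toLinearEquiv (e.toLinearEquiv.symm w)) at h1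
      rw [h1, LinearEquiv.apply_symm_apply, hw g hg]
    refine ⟨e.toLinearEquiv.symm w, hmem, ?_⟩
    rw [← he _ hmem]
    exact e.toLinearEquiv.apply_symm_apply w

/-- **Corollary (intertwiner form, no non-vanishing hypothesis).** Under the hypotheses of
`exists_equiv_of_heckeEquivariant` except `φ|_{V^K} ≠ 0`, the Hecke-equivariant `φ` agrees on
`V^K` with an intertwining map `ρ → σ` (the zero map if `φ|_{V^K} = 0`, an isomorphism otherwise) —
so Mathlib's `Representation.IsIrreducible.bijective_or_eq_zero` applies to it.
[cite: BushnellHenniart2006, §4.3 Proposition] -/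
theorem exists_intertwiningMap_of_heckeEquivariant [ρ.IsIrreducible] [σ.IsIrreducible]
    (hfin : ∀ g : G, (orbit K (g : G ⧸ K)).Finite) (φ : V →ₗ[k] W)
    (hφK : ∀ v ∈ ρ.fixedPoints K, φ v ∈ σ.fixedPoints K)
    (hφT : ∀ g : G, ∀ v ∈ ρ.fixedPoints K, φ (heckeOperator ρ K g v) = heckeOperator σ K g (φ v)) :
    ∃ Φ : ρ.IntertwiningMap σ, ∀ v ∈ ρ.fixedPoints K, Φ v = φ v := by
  by_cases h0 : ∃ v ∈ ρ.fixedPoints K, φ v ≠ 0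
  · obtain ⟨e, he⟩ := exists_equiv_of_heckeEquivariant ρ σ K hfin φ hφK hφT h0
    exact ⟨e.toIntertwiningMap, he⟩
  · push Not at h0
    exact ⟨0, fun v hv => by rw [h0 v hv]; rfl⟩

/-- **Corollary (non-isomorphic irreducibles are separated on `K`-fixed vectors)** — the form
consumed by multiplicity-one bookkeeping: if `ρ ≄ σ` are irreducible, EVERY Hecke-equivariant
linear map `V^K → W^K` (in the total-`φ` convention) vanishes on `V^K`.
[cite: BushnellHenniart2006, §4.3 Proposition] -/
theorem eq_zero_of_heckeEquivariant_of_isEmpty_equiv [ρ.IsIrreducible] [σ.IsIrreducible]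
    (hfin : ∀ g : G, (orbit K (g : G ⧸ K)).Finite) (hne : IsEmpty (ρ.Equiv σ)) (φ : V →ₗ[k] W)
    (hφK : ∀ v ∈ ρ.fixedPoints K, φ v ∈ σ.fixedPoints K)
    (hφT : ∀ g : G, ∀ v ∈ ρ.fixedPoints K, φ (heckeOperator ρ K g v) = heckeOperator σ K g (φ v)) :
    ∀ v ∈ ρ.fixedPoints K, φ v = 0 := by
  by_contra h
  push Not at h
  obtain ⟨e, _⟩ := exists_equiv_of_heckeEquivariant ρ σ K hfin φ hφK hφT h
  exact hne.false e

end Lift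

end Literature.NumberTheory.Automorphic
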